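import Summits.HodgeConjecture.HodgeConjecture.Theses.HCCMUnconditional
import Summits.HodgeConjecture.CorCM.HypLiu418.A3Liu418EtaleItems
import Summits.HodgeConjecture.CorCM.HypLiu418.A3Liu418Items
import Literature.NumberTheory.Automorphic.Liu2021.Thm418EpsRigidUnderGaloisTwist
import Literature.AlgebraicGeometry.ShimuraVarieties.UnitaryShimuraCanonicalModelUnique
import HarnessLib

/-!
# a3-liu418 FACE TYPES — the sixteen face-closure `Prop`s of the crux line `Cruxes/HLiu418/Lines/a3_liu418.lean` (binder `hLiu418`), IN THE TREE by name

Cell `hodgecm-mathlib` (D-0151), fan A, crux item HLiu418 = stmt-HodgeConjecture-24832 (route `HCCMUnconditional`).  DEFINITIONS ONLY (`def … : Prop` with bodies;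
no theorem, no instance, no notation, no `sorry`, no named fact — net Literature debt 0), namespace `Summit.HodgeConjecture.CorCM.Lines.A3Liu418` (that of the crux
file and of `A3Liu418Items.lean` ∕ `A3Liu418EtaleItems.lean`).  Same pattern and reason as A-p06's `A3Liu418EtaleItems.lean` (p598646) and A-p19's `A3Liu418Items.lean`
(p605885): «D-CLOSURE needs by-name stub TYPES» — the crux workfile is not importable (it carries the registered `sorry` slots), so the Theorems-side closing file
`Summits/HodgeConjecture/HodgeConjecture/Theorems/HCCMUnconditionalHLiu418OfFacts.lean` (`HLiu418_of_facts`, A-p18) and any future by-name closer state their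
types against THIS file.  The crux file may `import` it and drop its local copies (as v5 did with `A3Liu418Items`), or keep them: the bodies are identical, so every
slot unifies by `δ`-reduction either way.

CONTENTS = the tree crux file `a3_liu418.lean` **v6** (md5 `b3dbf6f37fa2…`, 605 lines; A-plan2 g1) lines :192–:399 BYTE-FOR-BYTE — the face closures
`StubMainGalois`, `StubLevelInvariants`, `StubNonIso` (items main+(3) ∕ (1) ∕ (2) of [Liu2021, Thm 4.18] at the transported datum `datumC`), `StubAlbTransitionEpi` (row VI-3),
`StubHonestIsogenyDescent` (row VI-4), `StubBettiThetaModel` ∕ `StubPinBettiPinning` ∕ `StubBettiThetaModelAtPlace` ∕ `StubBettiThetaModelOffPlace` ([Prop 4.13] pinned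
to the Albanese levels; rows III-4, III-0, I-4), `EtaleComparisonAtFace` (row VI-2″, face closure of `Sec42Data.exists_etaleHeckeDatum_with_bettiComparison`),
`StubEtaleBettiModel`, `StubFaltingsIsotypic` (row VI-1 inside), `StubGaloisLabelSeparation`, `Thm415AtFace` (row III-9′, face closure of `Thm415Pinned`),
`StubMainGaloisGlue` — PLUS one NEW name, `EpsRigidAtFace` := the type of the v6 residual `stub_epsRigidAtFace` (:539) verbatim (row III-11, face closure of
`Thm418Data.EpsRigidUnderGaloisTwist`).  Docstrings are those of the crux file (they say which tree theorem closes each slot).  NOTHING is asserted here.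
HC_CM is proved only modulo the 7 printed citations until rung 0 closes.

## References
* [Liu2021] Y. Liu, *Fourier–Jacobi cycles and arithmetic relative trace formula*, Camb. J. Math. 9 (2021) = arXiv:2102.11518: Thm. 4.18 and its proof
  (FJcycle.tex l. 2235–2290), Prop. 4.13, Thm. 4.15, Lem. 2.4, §4.2–4.3.
* Tree: `Cruxes/HLiu418/Lines/a3_liu418.lean` v6; `CorCM/HypLiu418/A3Liu418Items.lean` (p605885), `A3Liu418EtaleItems.lean` (p598646);
  `Liu2021/Thm418EpsRigidUnderGaloisTwist.lean` (p600012); `ShimuraVarieties/UnitaryShimuraCanonicalModelUnique.lean` (row I-4).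
-/

set_option autoImplicit false

noncomputable section

namespace Summit.HodgeConjecture.CorCM.Lines.A3Liu418

open scoped TensorProduct Matrix
open NumberField NumberField.InfinitePlace
open HodgeCM.Model HodgeCM.Model.LiuIndex HodgeCM.Model.TowerCarrier
open HodgeCM.Literature.Theta.LiuAlbaneseModuleDatum.D2Bridge (HcmPieces)
open Summit.HodgeConjecture.CorCM.Model
open Literature.AlgebraicGeometry.Motives (CMType)
open Literature.AlgebraicGeometry.HodgeTheory Literature.NumberTheory.Automorphic.PicardCM
open Literature.AlgebraicGeometry.ShimuraVarieties.UnitaryCanonicalModel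
open Literature.NumberTheory.ComplexMultiplication
open Literature.NumberTheory.Automorphic
open Literature.NumberTheory.Automorphic.IdeleClassGroup (toHeckeCharacter isUnitary_toHeckeCharacter galConj)
open Literature.NumberTheory.Automorphic.Liu2021 Literature.NumberTheory.Automorphic.Liu2021.AppendixC
open Literature.NumberTheory.Automorphic.Liu2021.AppendixC.RestOne
open Literature.NumberTheory.Automorphic.Liu2021.Def411WeilCarriers (lineOf locF Rep)
open Summit.HodgeConjecture.CorCM.Transposition.OmegaTransport (realUnit)
open HodgeCM.Model.ArchSideTerm (e₁)
open Literature.NumberTheory.GelbartRogawski1991 Literature.NumberTheory.GelbartRogawski1991.UnitaryDualPair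
open Literature.NumberTheory.GelbartRogawski1991.UnitaryDualPair.LocalSplitting (localMu norm_localMu continuous_localMu localMu_toLocalRing_eq_one_iff
  eq_of_forall_localMu_toHeckeCharacter_eq)
open Literature.RepresentationTheory Literature.RepresentationTheory.Liu2021
open Summit.HodgeConjecture.CorCM.Transposition
open Summit.HodgeConjecture.CorCM.D2Bridge.AdapterMuConj (muConj prop413AsPrinted_muConj def411_muConj nontrivial_omegaAt_muConj_rest)
open Summit.HodgeConjecture.CorCM.D2Bridge.MuKeyIdentEnd (hc_cm_of_printed_citations_muKey_ident)
open Summit.HodgeConjecture.CorCM.D2Bridge.MuKeyIdentLemD3End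
open Summit.HodgeConjecture.CorCM.D2Bridge.MuKeyIdentLemD3DelRecConjOmegaEnd (diagonal_frameD_map_complexConj)

open Summit.HodgeConjecture.CorCM.D2Bridge.MuKeyIdentLemD3DelRecConjOmegaEndT (hc_cm_of_printed_citations_muKey_ident_lemD3_delRecConjOmegaT)
open Summit.HodgeConjecture.CorCM.D2Bridge.MuKeyIdentLemD3DelRecConjOmegaEndT.PrintedCitationHypotheses (HypLiu418 Hyp411 Hyp413 HypD3 HypD1pp)  -- v4: decls of record
open Literature.AlgebraicGeometry.Motives (AbelianVariety)
open Literature.AlgebraicGeometry.Liu2021 (IsAdmissibleElement)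
open scoped DirectSum

/-! ## Registered stubs (v3: Liu's printed proof ¶1–¶3, ℓ-adic split of MAIN + (3); item (1) split (I)(D); item (2) closed) -/

set_option synthInstance.maxHeartbeats 400000 in
set_option maxHeartbeats 8000000 in
/-- STUB TYPE (main + (3)), closed over `hDel` like the decl of record.  For every `hDel` and every face prefix, under the space identification, the transported datum `D′` has the printed main isomorphism
`Ω(ν) ⊗_{M_ν} ℂ ≅ ⊕_{(ε,χ), ε ν-admissible} ω_{V^c}(ν,ε,χ)` of `ℂ[U(V^c)(𝔸_f)]`-modules together with item (3). -/
def StubMainGalois : Prop :=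
  ∀ (hDel : Literature.AlgebraicGeometry.ShimuraVarieties.UnitaryCanonicalModel.canonicalModel_exists_printed)
      (F : HodgeCM.CMField) [IsGalois ℚ F] (h6 : 6 ≤ Module.finrank ℚ F) {ι₁ : F →+* ℂ} (V : HodgeCM.HermSpace3 F ι₁) (a : RealScalar F)
      (Φ : CMType F) (hΦ : ι₁ ∈ Φ.1) (ν : Literature.NumberTheory.Automorphic.IdeleClassGroup (F : Type) →ₜ* Circle)
      (hν : IdeleClassGroup.IsConjugateSymplectic (F : Type) ν) (hw : IdeleClassGroup.HasWeight (F : Type) ν 1) (Φ' : CMType F),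
      SpaceIdent hDel F h6 V Φ → MainGalois (datumC hDel F h6 V a Φ ν hν hw Φ')

set_option synthInstance.maxHeartbeats 400000 in
set_option maxHeartbeats 8000000 in
/-- STUB TYPE (item (1)), closed over `hDel`: level invariants for `D′` (`V`'s Albanese–`A_ν` tower read through `g ↦ ḡ`). -/
def StubLevelInvariants : Prop :=
  ∀ (hDel : Literature.AlgebraicGeometry.ShimuraVarieties.UnitaryCanonicalModel.canonicalModel_exists_printed)
      (F : HodgeCM.CMField) [IsGalois ℚ F] (h6 : 6 ≤ Module.finrank ℚ F) {ι₁ : F →+* ℂ} (V : HodgeCM.HermSpace3 F ι₁) (a : RealScalar F)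
      (Φ : CMType F) (hΦ : ι₁ ∈ Φ.1) (ν : Literature.NumberTheory.Automorphic.IdeleClassGroup (F : Type) →ₜ* Circle)
      (hν : IdeleClassGroup.IsConjugateSymplectic (F : Type) ν) (hw : IdeleClassGroup.HasWeight (F : Type) ν 1) (Φ' : CMType F),
      LevelInvariants (datumC hDel F h6 V a Φ ν hν hw Φ')

set_option synthInstance.maxHeartbeats 400000 in
set_option maxHeartbeats 8000000 in
/-- STUB TYPE (item (2)), closed over `hDel`: pairwise non-isomorphy of the conjugate space's Weil summands `ω_{V^c}(ν,ε,χ)` over admissible `(ε,χ)`. -/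
def StubNonIso : Prop :=
  ∀ (hDel : Literature.AlgebraicGeometry.ShimuraVarieties.UnitaryCanonicalModel.canonicalModel_exists_printed)
      (F : HodgeCM.CMField) [IsGalois ℚ F] (h6 : 6 ≤ Module.finrank ℚ F) {ι₁ : F →+* ℂ} (V : HodgeCM.HermSpace3 F ι₁) (a : RealScalar F)
      (Φ : CMType F) (hΦ : ι₁ ∈ Φ.1) (ν : Literature.NumberTheory.Automorphic.IdeleClassGroup (F : Type) →ₜ* Circle)
      (hν : IdeleClassGroup.IsConjugateSymplectic (F : Type) ν) (hw : IdeleClassGroup.HasWeight (F : Type) ν 1) (Φ' : CMType F),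
      NonIso (datumC hDel F h6 V a Φ ν hν hw Φ')

set_option synthInstance.maxHeartbeats 400000 in
set_option maxHeartbeats 8000000 in
/-- STUB TYPE (v3, item (1) AG half — A-p07's IFACE-ROW (I) verbatim plus the face's degree guard `h6` (so `sec42DataOf = sec42DataOfFourLe` and `X_K = Sh_K` is proper: `Model.sec42DataOf_eq_of_four_le`, `sec42DataOfFourLe_X`); row VI-3): every transition morphism `Alb_{u^{K'}_K}` of `V`'s Albanese tower is an
EPIMORPHISM of abelian varieties (it is an isogeny onto its image followed by … — in print: `Alb` of a finite étale cover of connected smooth projective varieties is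
surjective). [cite: Liu2021, Thm 4.18 (1) proof (FJcycle.tex l. 2274–2282); Lem. 2.4 (1)] -/
def StubAlbTransitionEpi : Prop :=
  ∀ (hDel : Literature.AlgebraicGeometry.ShimuraVarieties.UnitaryCanonicalModel.canonicalModel_exists_printed)
      (F : HodgeCM.CMField) [IsGalois ℚ F] (h6 : 6 ≤ Module.finrank ℚ F) {ι₁ : F →+* ℂ} (V : HodgeCM.HermSpace3 F ι₁) (Φ : CMType F)
      ⦃K K' : C5.SmallLevel (CV hDel F V Φ).S.K₀⦄ (f : K' ⟶ K), CategoryTheory.Epi ((CV hDel F V Φ).Atr f)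

set_option synthInstance.maxHeartbeats 400000 in
set_option maxHeartbeats 8000000 in
/-- STUB TYPE (v3, item (1) descent half — (D); row VI-4): `V`'s Albanese Hecke translates satisfy ISOGENY DESCENT (`HeckeTranslates.IsogenyDescent`, A-p07
`RestOneLevelInvariantsHom.lean` :131): a class of `ℚ ⊗ Hom(Alb X_{K'}, B)` fixed by the finite group `K ∕ K'` acting through the Hecke translates `T_k` (`k ∈ K`) descends to
level `K` — Galois descent of homomorphisms along the Galois cover `X_{K'} → X_K` with group `K ∕ K'` [Liu21 Lem 2.4 (1)] plus `Hom(−, B)_ℚ` of an isogeny category.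
[cite: Liu2021, Thm 4.18 (1) proof (FJcycle.tex l. 2274–2282); Lem. 2.4 (1); Rem. 4.17] -/
def StubHonestIsogenyDescent : Prop :=
  ∀ (hDel : Literature.AlgebraicGeometry.ShimuraVarieties.UnitaryCanonicalModel.canonicalModel_exists_printed)
      (F : HodgeCM.CMField) [IsGalois ℚ F] (h6 : 6 ≤ Module.finrank ℚ F) {ι₁ : F →+* ℂ} (V : HodgeCM.HermSpace3 F ι₁) (Φ : CMType F),
      (TV hDel F h6 V Φ).IsogenyDescent

set_option synthInstance.maxHeartbeats 400000 in
set_option maxHeartbeats 8000000 in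
/-- STUB TYPE (v4 = v3 + the binder `(hΦ : ι₁ ∈ Φ.1)` (R-a, A-p06 02:39:09Z: [Prop 4.13] is only available at faces with `ι₁ ∈ Φ`); fan B with the A-side pinning junction inside; row III-4 at the Albanese tower + B-typ04's `BettiPinning`): for `V`'s own
datum there are an embedding `τ'`, a complex Betti tower module `(H, rhoB)` PINNED to the real levels `H¹((Alb X_K ×_{τ'} ℂ)(ℂ); ℂ)` along the
Albanese Hecke translates (B-typ04 `Sec42Data.BettiPinning`, p595473), and the [Prop 4.13] decomposition of `(H, rhoB)` over ALL labelled admissible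
triples of `muConj 𝕌_V` at `a` (`BettiThetaDecomposition`). [cite: Liu2021, §4.2 l. 2074–2081; Prop. 4.13; Thm 4.18 proof l. 2254–2257] -/
def StubBettiThetaModel : Prop :=
  ∀ (hDel : Literature.AlgebraicGeometry.ShimuraVarieties.UnitaryCanonicalModel.canonicalModel_exists_printed)
      (F : HodgeCM.CMField) [IsGalois ℚ F] (h6 : 6 ≤ Module.finrank ℚ F) {ι₁ : F →+* ℂ} (V : HodgeCM.HermSpace3 F ι₁) (a : RealScalar F) (Φ : CMType F) (hΦ : ι₁ ∈ Φ.1),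
      ∃ (τ' : (F : Type) →+* ℂ) (H : Type) (_ : AddCommGroup H) (_ : Module ℂ H) (rhoB : Representation ℂ (CV hDel F V Φ).G H),
        Nonempty ((CV hDel F V Φ).BettiPinning (TV hDel F h6 V Φ) τ' H rhoB) ∧ BettiThetaDecomposition (UV hDel F V a Φ) H rhoB

set_option synthInstance.maxHeartbeats 400000 in
set_option maxHeartbeats 8000000 in
/-- STUB TYPE (v4, P — GAP 1, row III-0 at the pin; the consequent of A-p18's `pinBettiPinning_of_lemma24` VERBATIM up to the face abbreviations `CV` ∕ `TV`):
at every face, THE PIN's tower module `(liuDictionaryPin …).H` with its `ℂ[𝔾(𝔸_F^∞)]`-action `Representation.ofModule'` is Betti-PINNED along some `τ'` to the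
Albanese levels of `V`'s own §4.2 datum `ℭ_V` (B-typ04's `Sec42Data.BettiPinning`).  Content: `H¹(X_K ×_{τ'} ℂ; ℂ) = H¹(Alb X_K ×_{τ'} ℂ; ℂ)` levelwise and
compatibly ([Liu21 Lem 2.4] = row III-0 `albanese_bettiOne_pullback_bijective`) + the pin law of `Map43RecordAtPinLevels` (A-p18 p602555).
[cite: Liu2021, Lem. 2.4; §4.2 l. 2074–2081] [cite: Lang1983AbelianVarieties, Ch. VII §2] -/
def StubPinBettiPinning : Prop :=
  ∀ (hDel : Literature.AlgebraicGeometry.ShimuraVarieties.UnitaryCanonicalModel.canonicalModel_exists_printed)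
      (F : HodgeCM.CMField) [IsGalois ℚ F] (h6 : 6 ≤ Module.finrank ℚ F) {ι₁ : F →+* ℂ} (V : HodgeCM.HermSpace3 F ι₁) (a : RealScalar F) (Φ : CMType F),
      ∃ τ' : (F : Type) →+* ℂ, Nonempty ((CV hDel F V Φ).BettiPinning (TV hDel F h6 V Φ) τ'
    ((liuDictionaryPin exists_isReal_hodgeModel_holds hodgePQ_independent_of_hodgeModel_holds BallQuotient.ballQuotientUniformised_holds
            (cmAbelianVarietyRealised_of_eigenbasis exists_isReal_hodgeModel_holds hodgePQ_independent_of_hodgeModel_holds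
              cmAbelianVarietyEigenbasisRealised_holds)
            Literature.NumberTheory.Transcendental.arapura2012_cor_15_4_6_holds V (I V (repAt a) (muLiu ι₁ GramClass.rep))
            (line V (repAt a) (muLiu ι₁ GramClass.rep))).H)
        (Representation.ofModule' _))

set_option synthInstance.maxHeartbeats 400000 in
set_option maxHeartbeats 8000000 in
/-- STUB TYPE (v4, P AT PLACE — the conclusion of A-p06's `bettiThetaModelAtPlace_of_hyp413_of_pinning` VERBATIM up to the face abbreviations): `StubBettiThetaModel`
restricted to the faces whose `ι₁` IS the chosen embedding of its infinite place, `(NumberField.InfinitePlace.mk ι₁).embedding = ι₁` — exactly the faces at which the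
headline row `h413` ([Prop 4.13] AS PRINTED at the pin) is available (`Hyp413` quantifies the face through `repAt a₀` at the place's embedding).  CLOSED below from
`h413` + `StubPinBettiPinning` (`stub_bettiThetaModelAtPlace_of`). [cite: Liu2021, Prop. 4.13 (FJcycle.tex l. 2110–2131); §4.2 l. 2074–2081] -/
def StubBettiThetaModelAtPlace : Prop :=
  ∀ (hDel : Literature.AlgebraicGeometry.ShimuraVarieties.UnitaryCanonicalModel.canonicalModel_exists_printed)
      (F : HodgeCM.CMField) [IsGalois ℚ F] (h6 : 6 ≤ Module.finrank ℚ F) {ι₁ : F →+* ℂ} (V : HodgeCM.HermSpace3 F ι₁)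
      (hemb : (NumberField.InfinitePlace.mk ι₁).embedding = ι₁) (a : RealScalar F) (Φ : CMType F) (hΦ : ι₁ ∈ Φ.1),
      ∃ (τ' : (F : Type) →+* ℂ) (H : Type) (_ : AddCommGroup H) (_ : Module ℂ H) (rhoB : Representation ℂ (CV hDel F V Φ).G H),
        Nonempty ((CV hDel F V Φ).BettiPinning (TV hDel F h6 V Φ) τ' H rhoB) ∧ BettiThetaDecomposition (UV hDel F V a Φ) H rhoB

set_option synthInstance.maxHeartbeats 400000 in
set_option maxHeartbeats 8000000 in
/-- STUB TYPE (v4, P OFF PLACE — the genuinely new A-side residual isolated by the cut): `StubBettiThetaModel` at the faces whose `ι₁` is NOT the chosen embedding of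
its place (then `conj ∘ ι₁` is).  Printed content: none beyond [Prop 4.13] — Liu's `Sh(V)` does not see which of the two conjugate embeddings names the place; in the
tree the pin is built at `(mk ι₁).embedding`, so the off-place faces need the MODEL COMPARISON between the record system of `(V, ι₁)` and the one read at the
conjugate embedding: B2 `RecordSystem.exists_alongConj` (A-p08 p604639) → frame change `RecordSystem.exists_of_frame` (A-p08 p605094) → B3 + I-4
`RecordSystem.nonempty_iso_of_canonicalModel_unique` (A-p02 p604883; THIS is where row I-4 `canonicalModel_unique_printed` [Del71 5.5] enters the cone) → transport
of the Betti pinning and of the theta decomposition along the model isomorphism (A-p16 `replaceΩ` p604143 + `Alb(φ_K)` on `H¹`, which uses row III-0 again).  Hence the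
registered residual below takes `H413`, I-4 and III-0 as antecedents. [cite: Liu2021, Prop. 4.13; §4.2] [cite: Deligne1971TravauxShimura, 5.5] -/
def StubBettiThetaModelOffPlace : Prop :=
  ∀ (hDel : Literature.AlgebraicGeometry.ShimuraVarieties.UnitaryCanonicalModel.canonicalModel_exists_printed)
      (F : HodgeCM.CMField) [IsGalois ℚ F] (h6 : 6 ≤ Module.finrank ℚ F) {ι₁ : F →+* ℂ} (V : HodgeCM.HermSpace3 F ι₁)
      (hoff : (NumberField.InfinitePlace.mk ι₁).embedding ≠ ι₁) (a : RealScalar F) (Φ : CMType F) (hΦ : ι₁ ∈ Φ.1),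
      ∃ (τ' : (F : Type) →+* ℂ) (H : Type) (_ : AddCommGroup H) (_ : Module ℂ H) (rhoB : Representation ℂ (CV hDel F V Φ).G H),
        Nonempty ((CV hDel F V Φ).BettiPinning (TV hDel F h6 V Φ) τ' H rhoB) ∧ BettiThetaDecomposition (UV hDel F V a Φ) H rhoB


set_option synthInstance.maxHeartbeats 400000 in
set_option maxHeartbeats 8000000 in
/-- HEAD HYPOTHESIS TYPE (v3; rows VI-2′/VI-2″ BY NAME — B-typ04's named fact `Sec42Data.exists_etaleHeckeDatum_with_bettiComparison` (p595473) closed over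
`V`'s own datum, its Albanese Hecke translates and EVERY pinned Betti tower module; discharged by the B side's `_holds` (debt row VI-2″), NOT a stub of this file
(D-0014; director 01:44:41Z «existence nobody can construct without étale cohomology ⇒ named fact, imported BY NAME»). [cite: Liu2021, §4.3 l. 2154–2160]
[cite: SGA4Tome3, Exp. XI Thm. 4.4] -/
def EtaleComparisonAtFace : Prop :=
  ∀ (hDel : Literature.AlgebraicGeometry.ShimuraVarieties.UnitaryCanonicalModel.canonicalModel_exists_printed)
      (F : HodgeCM.CMField) [IsGalois ℚ F] (h6 : 6 ≤ Module.finrank ℚ F) {ι₁ : F →+* ℂ} (V : HodgeCM.HermSpace3 F ι₁) (Φ : CMType F)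
      (ℓ : ℕ) [Fact ℓ.Prime] (τ' : (F : Type) →+* ℂ) (ι' : ℂ ≃+* AlgebraicClosure ℚ_[ℓ]) (H : Type) [AddCommGroup H] [Module ℂ H]
      (rhoB : Representation ℂ (CV hDel F V Φ).G H) (B : (CV hDel F V Φ).BettiPinning (TV hDel F h6 V Φ) τ' H rhoB),
      (CV hDel F V Φ).exists_etaleHeckeDatum_with_bettiComparison ℓ (TV hDel F h6 V Φ) τ' ι' H rhoB B

set_option synthInstance.maxHeartbeats 400000 in
set_option maxHeartbeats 8000000 in
/-- DERIVED TYPE (v4 = v3 + `(hΦ : ι₁ ∈ Φ.1)`): at every `(ℓ, ι)` an étale Hecke datum INDUCED by the Albanese translates (`EtaleHeckeDatum.IsInducedBy`, B-typ04) carrying the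
étale theta decomposition — from `StubBettiThetaModel` and `EtaleComparisonAtFace` by `stub_etaleBettiModel_of`. [cite: Liu2021, §4.3 l. 2152–2160; Prop. 4.13] -/
def StubEtaleBettiModel : Prop :=
  ∀ (hDel : Literature.AlgebraicGeometry.ShimuraVarieties.UnitaryCanonicalModel.canonicalModel_exists_printed)
      (F : HodgeCM.CMField) [IsGalois ℚ F] (h6 : 6 ≤ Module.finrank ℚ F) {ι₁ : F →+* ℂ} (V : HodgeCM.HermSpace3 F ι₁) (a : RealScalar F) (Φ : CMType F) (hΦ : ι₁ ∈ Φ.1)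
      (ℓ : ℕ) [Fact ℓ.Prime] (ι' : ℂ ≃+* AlgebraicClosure ℚ_[ℓ]), ∃ X : (CV hDel F V Φ).EtaleHeckeDatum ℓ,
        X.IsInducedBy (TV hDel F h6 V Φ) ∧ EtaleThetaDecomposition (UV hDel F V a Φ) ℓ X ι'

set_option synthInstance.maxHeartbeats 400000 in
set_option maxHeartbeats 8000000 in
/-- STUB TYPE (v3, fan A; Faltings step): for `V`'s own datum, every induced étale Hecke datum `X`, every `ι`, the label `ν` and the carriers of `A_ν`,
`FaltingsIsotypic` holds (the `ι`-semilinear identification of `ℂ ⊗_{M_ν} Ω(ν)` with the `α_ν`-Hom space into `ℚ_ℓ^{ac} ⊗ H¹_ét(A_∞)`). [cite: Liu2021, Thm 4.18 proof l. 2245–2263]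
[cite: Faltings1983] [cite: SerreTate1968, §4 Thm. 5] -/
def StubFaltingsIsotypic : Prop :=
  ∀ (hDel : Literature.AlgebraicGeometry.ShimuraVarieties.UnitaryCanonicalModel.canonicalModel_exists_printed)
      (F : HodgeCM.CMField) [IsGalois ℚ F] (h6 : 6 ≤ Module.finrank ℚ F) {ι₁ : F →+* ℂ} (V : HodgeCM.HermSpace3 F ι₁) (a : RealScalar F)
      (Φ : CMType F) (hΦ : ι₁ ∈ Φ.1) (ν : Literature.NumberTheory.Automorphic.IdeleClassGroup (F : Type) →ₜ* Circle)
      (hν : IdeleClassGroup.IsConjugateSymplectic (F : Type) ν) (hw : IdeleClassGroup.HasWeight (F : Type) ν 1)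
      (ℓ : ℕ) [Fact ℓ.Prime] (X : (CV hDel F V Φ).EtaleHeckeDatum ℓ) (ι' : ℂ ≃+* AlgebraicClosure ℚ_[ℓ]),
      X.IsInducedBy (TV hDel F h6 V Φ) →
        FaltingsIsotypic (TV hDel F h6 V Φ) (AlgHom.id ℚ _) ι₁ hν hw (CarN F ι₁ ν hν) ℓ X ι'

set_option synthInstance.maxHeartbeats 400000 in
set_option maxHeartbeats 8000000 in
/-- STUB TYPE (v3; Galois separation of labels): for `V`'s own datum, the family `muConj 𝕌_V` at `a`, every induced `X`, every `ι`, `GaloisLabelSeparation` holds at `ν`.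
[cite: Liu2021, Thm 4.15; Thm 4.18 proof l. 2258–2266; Def. 4.5 (2)] -/
def StubGaloisLabelSeparation : Prop :=
  ∀ (hDel : Literature.AlgebraicGeometry.ShimuraVarieties.UnitaryCanonicalModel.canonicalModel_exists_printed)
      (F : HodgeCM.CMField) [IsGalois ℚ F] (h6 : 6 ≤ Module.finrank ℚ F) {ι₁ : F →+* ℂ} (V : HodgeCM.HermSpace3 F ι₁) (a : RealScalar F)
      (Φ : CMType F) (hΦ : ι₁ ∈ Φ.1) (ν : Literature.NumberTheory.Automorphic.IdeleClassGroup (F : Type) →ₜ* Circle)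
      (hν : IdeleClassGroup.IsConjugateSymplectic (F : Type) ν) (hw : IdeleClassGroup.HasWeight (F : Type) ν 1)
      (ℓ : ℕ) [Fact ℓ.Prime] (X : (CV hDel F V Φ).EtaleHeckeDatum ℓ) (ι' : ℂ ≃+* AlgebraicClosure ℚ_[ℓ]),
      X.IsInducedBy (TV hDel F h6 V Φ) →
        GaloisLabelSeparation (UV hDel F V a Φ) (AlgHom.id ℚ _) ι₁ hν hw (CarN F ι₁ ν hν) ℓ X ι'

set_option synthInstance.maxHeartbeats 400000 in
set_option maxHeartbeats 8000000 in
/-- HEAD HYPOTHESIS TYPE (v3; [Thm 4.15] BY NAME — B-typ04's named fact `Thm415Pinned` (p593306) instantiated at `(ℭ_V, muConj 𝕌_V at a, ν, A_ν, i_ν)` for every induced `X`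
and every `ι`; discharged by the B side's `Thm415Pinned` `_holds` (row III-6 ∕ VI, [MR92 Prop. 6] XL), NOT a stub of this file (D-0014).  THIS instantiation carries the orientation
question S1 (A3-ORIENTATION §3): it says `Γ_E` acts on the `ω_{muConj 𝕌_V}(ν,ε,χ) = ω_V(νᶜ,ε,χ)`-isotypic part of `H¹_ét(Sh(V)_∞)` through `ν^{alg}`. [cite: Liu2021, Thm 4.15 (FJcycle.tex
l. 2177–2182)] [cite: MurtyRamakrishnan1992, Prop. 6] -/
def Thm415AtFace : Prop :=
  ∀ (hDel : Literature.AlgebraicGeometry.ShimuraVarieties.UnitaryCanonicalModel.canonicalModel_exists_printed)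
      (F : HodgeCM.CMField) [IsGalois ℚ F] (h6 : 6 ≤ Module.finrank ℚ F) {ι₁ : F →+* ℂ} (V : HodgeCM.HermSpace3 F ι₁) (a : RealScalar F)
      (Φ : CMType F) (hΦ : ι₁ ∈ Φ.1) (ν : Literature.NumberTheory.Automorphic.IdeleClassGroup (F : Type) →ₜ* Circle)
      (hν : IdeleClassGroup.IsConjugateSymplectic (F : Type) ν) (hw : IdeleClassGroup.HasWeight (F : Type) ν 1)
      (ℓ : ℕ) [Fact ℓ.Prime] (X : (CV hDel F V Φ).EtaleHeckeDatum ℓ) (ι' : ℂ ≃+* AlgebraicClosure ℚ_[ℓ])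
      (obj : RestOne.ObjOne (AlgHom.id ℚ _) ι₁ hν hw (CarN F ι₁ ν hν)),
      X.IsInducedBy (TV hDel F h6 V Φ) →
        Thm415Pinned (CV hDel F V Φ) (UV hDel F V a Φ) ℓ X ι' ν hν (RestOne.AμOne (AlgHom.id ℚ _) ι₁ hν hw (CarN F ι₁ ν hν) obj)
          (RestOne.iOne (AlgHom.id ℚ _) ι₁ hν hw (CarN F ι₁ ν hν) obj)

set_option synthInstance.maxHeartbeats 400000 in
set_option maxHeartbeats 8000000 in
/-- STUB TYPE (v3, fan A; the GLUE of Liu's ℓ-adic argument, l. 2245–2272): from [Def 4.11] for `V`'s family (`Hyp411`, closed pack decl), for every face prefix under the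
space identification — GIVEN, at every `(ℓ, ι)`, an étale Hecke datum induced by the Albanese translates (`IsInducedBy`, B-typ04) with its Betti theta decomposition, the Faltings identification, [Thm 4.15] at `ν` and the label
separation — and GIVEN item (2) at `D′`, the main statement + (3) of [Thm 4.18] holds at `D′ = datumC …`.  Content: (G1) pick `ℓ, ι`; `Ψ` identifies `ℂ ⊗ Ω(ν)` with the
`α_ν`-Hom space, which by the decomposition and separation is `⊕_{t : μ_t = ν} Hom_𝔾(…)`-free: `≅ ⊕_{(ε,χ) adm} ω(ν,ε,χ)` as `ℂ[𝔾]`-modules (Schur for the irreducible admissible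
`ω`'s, `Hyp411`; multiplicity one from item (2)); (G2) item (3): `σ ∈ Aut(ℂ ∕ M_ν)` acts on `ℂ ⊗ Ω(ν)` through the first factor and carries the `ω(ν,ε,χ)`-isotypic subspace to the
`ω(ν,ε,χ^σ)`-isotypic one — the local theta dichotomy is `Aut(ℂ ∕ M_ν)`-equivariant in `χ` with `ε` FIXED ([BH06 §41.2 (2)], [HKS96]); (G3) transport `D₀ ↦ D′` along
`Thm418Data.transport` (`G ↦ U(V^c)` via `adelicFinConj`, carriers `𝕌_{V^c}.omega ν`) using the IN-KERNEL dictionary `HComp.OmegaConj.exists_uniformOmegaRep_conj_hermConj` ∕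
`MuConjIdent.thm418AsPrinted_muConj_rest_transport_hermConj` (as A-p08's NonIso §1–§4 did for item (2)).  Foreseen glued split (tenure): G1 ∕ G2 ∕ G3.
[cite: Liu2021, Thm 4.18 proof (FJcycle.tex l. 2245–2272)] [cite: BushnellHenniart2006, §41.2 (2)] [cite: HarrisKudlaSweet1996] -/
def StubMainGaloisGlue : Prop :=
  Hyp411 →
  ∀ (hDel : Literature.AlgebraicGeometry.ShimuraVarieties.UnitaryCanonicalModel.canonicalModel_exists_printed)
      (F : HodgeCM.CMField) [IsGalois ℚ F] (h6 : 6 ≤ Module.finrank ℚ F) {ι₁ : F →+* ℂ} (V : HodgeCM.HermSpace3 F ι₁) (a : RealScalar F)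
      (Φ : CMType F) (hΦ : ι₁ ∈ Φ.1) (ν : Literature.NumberTheory.Automorphic.IdeleClassGroup (F : Type) →ₜ* Circle)
      (hν : IdeleClassGroup.IsConjugateSymplectic (F : Type) ν) (hw : IdeleClassGroup.HasWeight (F : Type) ν 1) (Φ' : CMType F),
      SpaceIdent hDel F h6 V Φ →
      (∀ (ℓ : ℕ) [Fact ℓ.Prime] (ι' : ℂ ≃+* AlgebraicClosure ℚ_[ℓ]), ∃ X : (CV hDel F V Φ).EtaleHeckeDatum ℓ,
          X.IsInducedBy (TV hDel F h6 V Φ) ∧ EtaleThetaDecomposition (UV hDel F V a Φ) ℓ X ι' ∧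
          FaltingsIsotypic (TV hDel F h6 V Φ) (AlgHom.id ℚ _) ι₁ hν hw (CarN F ι₁ ν hν) ℓ X ι' ∧
          (∀ obj : RestOne.ObjOne (AlgHom.id ℚ _) ι₁ hν hw (CarN F ι₁ ν hν),
              Thm415Pinned (CV hDel F V Φ) (UV hDel F V a Φ) ℓ X ι' ν hν (RestOne.AμOne (AlgHom.id ℚ _) ι₁ hν hw (CarN F ι₁ ν hν) obj)
                (RestOne.iOne (AlgHom.id ℚ _) ι₁ hν hw (CarN F ι₁ ν hν) obj)) ∧
          GaloisLabelSeparation (UV hDel F V a Φ) (AlgHom.id ℚ _) ι₁ hν hw (CarN F ι₁ ν hν) ℓ X ι') →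
      NonIso (datumC hDel F h6 V a Φ ν hν hw Φ') → MainGalois (datumC hDel F h6 V a Φ ν hν hw Φ')

set_option synthInstance.maxHeartbeats 400000 in
set_option maxHeartbeats 8000000 in
/-- FACE TYPE (NEW NAME; the type of the v6 residual `stub_epsRigidAtFace` :539 verbatim; row III-11 (G2)): ε-RIGIDITY UNDER GALOIS TWIST at `V`'s own relabelled
one-object rest `D₀ = toThm418Data ℭ_V ((muConj 𝕌_V).rest t_ν)` — B-typ04's named fact `Thm418Data.EpsRigidUnderGaloisTwist` (p600012) closed over the face; the `hGT`
hypothesis of A-p19's `stub_mainGaloisGlue_of` (p606438). [cite: Liu2021, Thm. 4.18 (3) proof (FJcycle.tex l. 2272–2290); App. D Lem. D.1 (3)] [cite: BushnellHenniart2006, §41.2 (2)] -/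
def EpsRigidAtFace : Prop :=
    ∀ (hDel : Literature.AlgebraicGeometry.ShimuraVarieties.UnitaryCanonicalModel.canonicalModel_exists_printed)
      (F : HodgeCM.CMField) [IsGalois ℚ F] (h6 : 6 ≤ Module.finrank ℚ F) {ι₁ : F →+* ℂ} (V : HodgeCM.HermSpace3 F ι₁) (a : RealScalar F)
      (Φ : CMType F) (hΦ : ι₁ ∈ Φ.1) (ν : Literature.NumberTheory.Automorphic.IdeleClassGroup (F : Type) →ₜ* Circle)
      (hν : IdeleClassGroup.IsConjugateSymplectic (F : Type) ν) (hw : IdeleClassGroup.HasWeight (F : Type) ν 1),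
      (toThm418Data (CV hDel F V Φ) ((UV hDel F V a Φ).rest (restTailOne (AlgHom.id ℚ _) ι₁ hν hw (CarN F ι₁ ν hν) ((TV hDel F h6 V Φ).rhoΩOne (AlgHom.id ℚ _) ι₁ hν hw (CarN F ι₁ ν hν))))).EpsRigidUnderGaloisTwist

end Summit.HodgeConjecture.CorCM.Lines.A3Liu418

end
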